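import Mathlib
import Summits.NavierStokesRegularity.NavierStokesRegularity.Theorems.FrozenSignCascadeEnvelopeBoundReduction
import Summits.NavierStokesRegularity.NavierStokesRegularity.Theorems.FrozenSignCascadeEnvelopeBoundWeightedDeriv
import Summits.NavierStokesRegularity.NavierStokesRegularity.Theorems.FrozenSignCascadeEnvelopeBoundStubProductionL2
import Summits.NavierStokesRegularity.NavierStokesRegularity.Theorems.FrozenSignCascadeEnvelopeBoundStubAgmonL1
import HarnessLib

/-!
# Route FrozenSignCascade · crux `EnvelopeBound` (stmt-NavierStokesRegularity-1549): Leray's lemma for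
  Fourier-side mild solutions — small energy × enstrophy freezes the enstrophy

Support file for the crux item stmt-NavierStokesRegularity-1549 (`EnvelopeBound`, route `FrozenSignCascade`,
line `registered`, reshape r3, lead c3); lands `--supports` that item. It assembles the landed slice-level stubs
of reshape r3 (`Leray.stub_productionL2`, `Leray.stub_agmonL1`) with the calculus layer
(`Leray.hasDerivAt_enstrophy`) into

* `enstrophyBalance`: `Ens'(t) = -2c·D(t) + P`, `|P| ≤ K·Ens(t)^{3/4}·D(t)^{3/4}` (`K` absolute) at interior
  times of every Fourier-mild solution on `ℝ³` (`Ens = ∫‖ξ‖²∑ₗ‖Vₗ‖²`, `D = ∫‖ξ‖⁴∑ₗ‖Vₗ‖²`) — the Fourier form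
  of Leray's differential inequality `d/dt‖∇u‖² ≤ -2ν‖Δu‖² + C‖∇u‖^{3/2}‖Δu‖^{3/2}`;
* `leray_threshold` (**Leray 1934, §22**): an absolute `θ > 0` such that `E(s)·Ens(s) ≤ θc⁴` at some time `s`
  forces `Ens(t) ≤ Ens(s)` for all later `t` (continuity/bootstrap argument on the closed set `{Ens ≤ Ens(s)}`
  with the mean value theorem, Cauchy–Schwarz `Ens² ≤ E·D` and the energy inequality `Registered.energyIneq`).

References: J. Leray, Acta Math. 63 (1934) §§20–22; P. G. Lemarié-Rieusset, *The Navier–Stokes problem in the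
21st century* (2016), Thm. 7.3; W. S. Ożański, B. C. Pooley, LMS LN 452 (2018), §6.3.
-/

noncomputable section

set_option linter.dupNamespace false -- nested layout Summit.<S>.<Sub>, Sub = S (D-0017)

open Set MeasureTheory Filter Topology Real
open Literature.Analysis.FluidPDE Literature.Analysis.FluidPDE.FourierNS
open Summit.NavierStokesRegularity.NavierStokesRegularity.Theorems.EnvelopeBound

namespace Summit.NavierStokesRegularity.NavierStokesRegularity.Theorems.EnvelopeBound.Leray

/-! ### Integrability of the quadratic functionals along a mild solution -/

section Integrability

variable {c t₀ t₁ : ℝ} {K₀ : ℕ} {V : ℝ → EuclideanSpace ℝ (Fin 3) → Fin 3 → ℂ}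

/-- The component energy density `∑ₗ ‖V(r,ξ)ₗ‖²` is integrable. -/
theorem integrable_sumSq (h : IsFourierMild c K₀ t₀ t₁ V) (r : ℝ) :
    Integrable fun ξ : EuclideanSpace ℝ (Fin 3) => ∑ l, ‖V r ξ l‖ ^ 2 := by
  obtain ⟨A, hA⟩ := h.decay (0 + K₀)
  have hb : ∀ ξ : EuclideanSpace ℝ (Fin 3), |(fun _ => (1:ℝ)) ξ| ≤ (1 + ‖ξ‖) ^ 0 := fun ξ => by simp
  have hmeas : AEStronglyMeasurable
      (fun ξ : EuclideanSpace ℝ (Fin 3) => (fun _ => (1:ℝ)) ξ * ∑ l, ‖V r ξ l‖ ^ 2) volume :=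
    (continuous_const.mul (continuous_finsetSum _ fun l _ =>
      ((continuous_apply l).comp (h.continuous_slice r)).norm.pow 2)).aestronglyMeasurable
  have h1 : Integrable (fun ξ : EuclideanSpace ℝ (Fin 3) => (fun _ => (1:ℝ)) ξ * ∑ l, ‖V r ξ l‖ ^ 2) :=
    (((integrable_inv_one_add_norm_pow (finrank_lt_of_card_lt h.hK₀)).const_mul
      (Fintype.card (Fin 3) * A ^ 2)).mono' hmeas
      (Eventually.of_forall fun ξ => Leray.norm_weightedSq_le hb hA r ξ))
  simpa using h1

/-- The weighted densities `‖ξ‖ⁿ ∑ₗ ‖V(r,ξ)ₗ‖²` are integrable. -/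
theorem integrable_pow_mul_sumSq (h : IsFourierMild c K₀ t₀ t₁ V) (n : ℕ) (r : ℝ) :
    Integrable fun ξ : EuclideanSpace ℝ (Fin 3) => ‖ξ‖ ^ n * ∑ l, ‖V r ξ l‖ ^ 2 := by
  obtain ⟨A, hA⟩ := h.decay (n + K₀)
  have hb : ∀ ξ : EuclideanSpace ℝ (Fin 3), |‖ξ‖ ^ n| ≤ (1 + ‖ξ‖) ^ n := fun ξ => by
    rw [abs_of_nonneg (by positivity)]
    exact pow_le_pow_left₀ (norm_nonneg _) (by linarith [norm_nonneg ξ]) n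
  exact (((integrable_inv_one_add_norm_pow (finrank_lt_of_card_lt h.hK₀)).const_mul
    (Fintype.card (Fin 3) * A ^ 2)).mono'
    (((continuous_norm.pow n).mul (continuous_finsetSum _ fun l _ =>
      ((continuous_apply l).comp (h.continuous_slice r)).norm.pow 2)).aestronglyMeasurable)
    (Eventually.of_forall fun ξ => Leray.norm_weightedSq_le hb hA r ξ))

/-- **Cauchy–Schwarz: `Ens² ≤ E · D`** (`‖ξ‖²∑‖Vₗ‖² = √(∑‖Vₗ‖²) · ‖ξ‖²√(∑‖Vₗ‖²)` and
`sq_integral_mul_le_of_integrable`). -/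
theorem enstrophy_sq_le (h : IsFourierMild c K₀ t₀ t₁ V) (r : ℝ) :
    (∫ ξ, ‖ξ‖ ^ 2 * ∑ l, ‖V r ξ l‖ ^ 2) ^ 2 ≤
      (∫ ξ, ∑ l, ‖V r ξ l‖ ^ 2) * ∫ ξ, ‖ξ‖ ^ 4 * ∑ l, ‖V r ξ l‖ ^ 2 := by
  set S : EuclideanSpace ℝ (Fin 3) → ℝ := fun ξ => ∑ l, ‖V r ξ l‖ ^ 2 with hS
  have hS0 : ∀ ξ, 0 ≤ S ξ := fun ξ => Finset.sum_nonneg fun l _ => sq_nonneg _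
  set f : EuclideanSpace ℝ (Fin 3) → ℝ := fun ξ => Real.sqrt (S ξ) with hf
  set g : EuclideanSpace ℝ (Fin 3) → ℝ := fun ξ => ‖ξ‖ ^ 2 * Real.sqrt (S ξ) with hg
  have hf2 : ∀ ξ, f ξ ^ 2 = S ξ := fun ξ => Real.sq_sqrt (hS0 ξ)
  have hg2 : ∀ ξ, g ξ ^ 2 = ‖ξ‖ ^ 4 * S ξ := fun ξ => by
    simp only [hg]; rw [mul_pow, Real.sq_sqrt (hS0 ξ)]; ring
  have hfg : ∀ ξ, f ξ * g ξ = ‖ξ‖ ^ 2 * S ξ := fun ξ => by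
    simp only [hf, hg]
    calc Real.sqrt (S ξ) * (‖ξ‖ ^ 2 * Real.sqrt (S ξ)) = ‖ξ‖ ^ 2 * (Real.sqrt (S ξ)) ^ 2 := by ring
      _ = ‖ξ‖ ^ 2 * S ξ := by rw [Real.sq_sqrt (hS0 ξ)]
  have h1 := sq_integral_mul_le_of_integrable (μ := volume) (f := f) (g := g)
    ((integrable_sumSq h r).congr (Eventually.of_forall fun ξ => (hf2 ξ).symm))
    ((integrable_pow_mul_sumSq h 4 r).congr (Eventually.of_forall fun ξ => (hg2 ξ).symm))
    ((integrable_pow_mul_sumSq h 2 r).congr (Eventually.of_forall fun ξ => (hfg ξ).symm))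
  simp only [hf2, hg2, hfg] at h1
  exact h1

end Integrability

/-! ### The enstrophy balance with Leray's production bound -/

/-- Powers bookkeeping: for `x > 0`, `x^{1/2} = x^{1/4} x^{1/4}` and `x^{3/4} = x^{1/2} x^{1/4}`. -/
theorem rpow_half_eq {x : ℝ} (hx : 0 < x) : x ^ (1 / 2 : ℝ) = x ^ (1 / 4 : ℝ) * x ^ (1 / 4 : ℝ) := by
  rw [← Real.rpow_add hx]; norm_num

/-- Powers bookkeeping: for `x > 0`, `x^{3/4} = x^{1/2} x^{1/4}`. -/
theorem rpow_three_quarters_eq {x : ℝ} (hx : 0 < x) :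
    x ^ (3 / 4 : ℝ) = x ^ (1 / 2 : ℝ) * x ^ (1 / 4 : ℝ) := by
  rw [← Real.rpow_add hx]; norm_num

/-- **The enstrophy balance** (from `stub_productionL2` and `stub_agmonL1`): there is an absolute `K ≥ 0` such
that for every Fourier-mild `V` on `[t₀,t₁]` and every interior `t`, `Ens' (t) = -2c·D(t) + P` with
`|P| ≤ K·Ens(t)^{3/4}·D(t)^{3/4}`. Proof: `Ens' = -2cD − 2Pr` (`Leray.hasDerivAt_enstrophy`, landed);
`|Pr| ≤ K₁ D^{1/2} M Ens^{1/2}` with `M = ∫‖V(t)‖` (stub 4) and `M ≤ K₂(ρ^{1/2}Ens^{1/2} + ρ^{-1/2}D^{1/2})`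
(stub 5) at `ρ = (D/Ens)^{1/2}`, i.e. `M ≤ 2K₂ Ens^{1/4}D^{1/4}`; the degenerate cases `D = 0` / `Ens = 0` give
`Pr = 0` directly. `K = 4K₁K₂`. -/
theorem enstrophyBalance :
    ∃ K : ℝ, 0 ≤ K ∧ ∀ (c : ℝ) (K₀ : ℕ) (t₀ t₁ : ℝ) (V : ℝ → EuclideanSpace ℝ (Fin 3) → Fin 3 → ℂ),
      Literature.Analysis.FluidPDE.FourierNS.IsFourierMild c K₀ t₀ t₁ V →
      ∀ t ∈ Set.Ioo t₀ t₁, ∃ P : ℝ,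
        HasDerivAt (fun r => ∫ ξ, ‖ξ‖ ^ 2 * ∑ l, ‖V r ξ l‖ ^ 2)
          (-(2 * c) * (∫ ξ, ‖ξ‖ ^ 4 * ∑ l, ‖V t ξ l‖ ^ 2) + P) t ∧
        |P| ≤ K * (∫ ξ, ‖ξ‖ ^ 2 * ∑ l, ‖V t ξ l‖ ^ 2) ^ (3 / 4 : ℝ) *
          (∫ ξ, ‖ξ‖ ^ 4 * ∑ l, ‖V t ξ l‖ ^ 2) ^ (3 / 4 : ℝ) := by
  obtain ⟨K₁, hK₁, hprod⟩ := stub_productionL2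
  obtain ⟨K₂, hK₂, hagm⟩ := stub_agmonL1
  refine ⟨4 * K₁ * K₂, by positivity, ?_⟩
  intro c K₀ t₀ t₁ V h t ht
  have hdec : ∀ K : ℕ, ∃ A : ℝ, HasDecay K A (V t) := fun K => (h.decay K).imp fun A hA => hA t
  set Ens : ℝ := ∫ ξ, ‖ξ‖ ^ 2 * ∑ l, ‖V t ξ l‖ ^ 2 with hEns
  set D : ℝ := ∫ ξ, ‖ξ‖ ^ 4 * ∑ l, ‖V t ξ l‖ ^ 2 with hD
  set M : ℝ := ∫ ξ, ‖V t ξ‖ with hM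
  set Pr : ℝ := ∫ ξ, ‖ξ‖ ^ 2 * ∑ l, ((starRingEnd ℂ) (V t ξ l) * nonlin (V t) (V t) ξ l).re with hPr
  have hEns0 : 0 ≤ Ens := integral_nonneg fun ξ => by positivity
  have hD0 : 0 ≤ D := integral_nonneg fun ξ => by positivity
  have hM0 : 0 ≤ M := integral_nonneg fun ξ => norm_nonneg _
  have hder := (Leray.hasDerivAt_enstrophy h ht).2
  refine ⟨-2 * Pr, ?_, ?_⟩
  · convert hder using 1; simp only [hPr, hD]; ring
  have hPrle : |Pr| ≤ K₁ * D ^ (1 / 2 : ℝ) * M * Ens ^ (1 / 2 : ℝ) := hprod (V t) (h.continuous_slice t) hdec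
  have habs : |(-2 : ℝ) * Pr| = 2 * |Pr| := by rw [abs_mul, abs_neg, abs_two]
  rw [habs]
  have hRHS0 : 0 ≤ 4 * K₁ * K₂ * Ens ^ (3 / 4 : ℝ) * D ^ (3 / 4 : ℝ) := by positivity
  rcases eq_or_lt_of_le hD0 with hD00 | hDpos
  · -- `D = 0`: the production vanishes
    have : |Pr| ≤ 0 := by
      calc |Pr| ≤ K₁ * D ^ (1 / 2 : ℝ) * M * Ens ^ (1 / 2 : ℝ) := hPrle
        _ = 0 := by rw [← hD00, Real.zero_rpow (by norm_num)]; ring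
    linarith
  rcases eq_or_lt_of_le hEns0 with hE00 | hEnspos
  · -- `Ens = 0`: the production vanishes
    have : |Pr| ≤ 0 := by
      calc |Pr| ≤ K₁ * D ^ (1 / 2 : ℝ) * M * Ens ^ (1 / 2 : ℝ) := hPrle
        _ = 0 := by rw [← hE00, Real.zero_rpow (by norm_num)]; ring
    linarith
  -- both positive: optimise `ρ = (D/Ens)^{1/2}`
  set ρ : ℝ := (D / Ens) ^ (1 / 2 : ℝ) with hρ
  have hρpos : 0 < ρ := Real.rpow_pos_of_pos (div_pos hDpos hEnspos) _
  have hMle := hagm (V t) (h.continuous_slice t) hdec ρ hρpos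
  -- `ρ^{1/2} Ens^{1/2} = D^{1/4} Ens^{1/4}` and `ρ^{-1/2} D^{1/2} = D^{1/4} Ens^{1/4}`
  have hq1 : ρ ^ (1 / 2 : ℝ) = D ^ (1 / 4 : ℝ) / Ens ^ (1 / 4 : ℝ) := by
    rw [hρ, ← Real.rpow_mul (div_pos hDpos hEnspos).le, Real.div_rpow hDpos.le hEnspos.le]
    norm_num
  have hq2 : ρ ^ (-(1 / 2) : ℝ) = Ens ^ (1 / 4 : ℝ) / D ^ (1 / 4 : ℝ) := by
    rw [hρ, ← Real.rpow_mul (div_pos hDpos hEnspos).le,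
      show (1 / 2 : ℝ) * -(1 / 2) = -(1 / 4) by norm_num, Real.rpow_neg (div_pos hDpos hEnspos).le,
      Real.div_rpow hDpos.le hEnspos.le, inv_div]
  have hE4 : 0 < Ens ^ (1 / 4 : ℝ) := Real.rpow_pos_of_pos hEnspos _
  have hD4 : 0 < D ^ (1 / 4 : ℝ) := Real.rpow_pos_of_pos hDpos _
  have e1 : ρ ^ (1 / 2 : ℝ) * Ens ^ (1 / 2 : ℝ) = D ^ (1 / 4 : ℝ) * Ens ^ (1 / 4 : ℝ) := by
    rw [hq1, rpow_half_eq hEnspos]; field_simp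
  have e2 : ρ ^ (-(1 / 2) : ℝ) * D ^ (1 / 2 : ℝ) = D ^ (1 / 4 : ℝ) * Ens ^ (1 / 4 : ℝ) := by
    rw [hq2, rpow_half_eq hDpos]; field_simp
  have hM2 : M ≤ 2 * K₂ * (D ^ (1 / 4 : ℝ) * Ens ^ (1 / 4 : ℝ)) := by
    calc M ≤ K₂ * (ρ ^ (1 / 2 : ℝ) * Ens ^ (1 / 2 : ℝ) + ρ ^ (-(1 / 2) : ℝ) * D ^ (1 / 2 : ℝ)) := hMle
      _ = 2 * K₂ * (D ^ (1 / 4 : ℝ) * Ens ^ (1 / 4 : ℝ)) := by rw [e1, e2]; ring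
  calc 2 * |Pr| ≤ 2 * (K₁ * D ^ (1 / 2 : ℝ) * M * Ens ^ (1 / 2 : ℝ)) := by linarith
    _ ≤ 2 * (K₁ * D ^ (1 / 2 : ℝ) * (2 * K₂ * (D ^ (1 / 4 : ℝ) * Ens ^ (1 / 4 : ℝ))) * Ens ^ (1 / 2 : ℝ)) := by
        gcongr
    _ = 4 * K₁ * K₂ * (Ens ^ (1 / 2 : ℝ) * Ens ^ (1 / 4 : ℝ)) * (D ^ (1 / 2 : ℝ) * D ^ (1 / 4 : ℝ)) := by ring
    _ = 4 * K₁ * K₂ * Ens ^ (3 / 4 : ℝ) * D ^ (3 / 4 : ℝ) := by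
        rw [← rpow_three_quarters_eq hEnspos, ← rpow_three_quarters_eq hDpos]

/-! ### Leray's lemma from the enstrophy balance -/

/-- Algebra of Leray's lemma: with `K' ≥ 0`, `Ens, D ≥ 0`, `Ens² ≤ E·D` and `K'⁴·(E·Ens) ≤ 16c⁴`
(`c ≥ 0`), the production is dominated by the dissipation: `K' Ens^{3/4} D^{3/4} ≤ 2c D`. -/
theorem production_le_dissipation {K' Ens E D c : ℝ} (hK' : 0 ≤ K') (hEns : 0 ≤ Ens)
    (hD : 0 ≤ D) (hc : 0 ≤ c) (hCS : Ens ^ 2 ≤ E * D) (hsmall : K' ^ 4 * (E * Ens) ≤ 16 * c ^ 4) :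
    K' * Ens ^ (3 / 4 : ℝ) * D ^ (3 / 4 : ℝ) ≤ 2 * c * D := by
  -- `K'⁴ Ens³ ≤ 16 c⁴ D`
  have h1 : K' ^ 4 * Ens ^ 3 ≤ 16 * c ^ 4 * D := by
    calc K' ^ 4 * Ens ^ 3 = K' ^ 4 * Ens * Ens ^ 2 := by ring
      _ ≤ K' ^ 4 * Ens * (E * D) := mul_le_mul_of_nonneg_left hCS (by positivity)
      _ = K' ^ 4 * (E * Ens) * D := by ring
      _ ≤ 16 * c ^ 4 * D := mul_le_mul_of_nonneg_right hsmall hD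
  -- fourth roots: `K' Ens^{3/4} ≤ 2c D^{1/4}`
  have hroot : K' * Ens ^ (3 / 4 : ℝ) ≤ 2 * c * D ^ (1 / 4 : ℝ) := by
    have ha : 0 ≤ K' * Ens ^ (3 / 4 : ℝ) := by positivity
    have hb : 0 ≤ 2 * c * D ^ (1 / 4 : ℝ) := by positivity
    refine (pow_le_pow_iff_left₀ ha hb (by norm_num : (4:ℕ) ≠ 0)).1 ?_
    have e1 : (K' * Ens ^ (3 / 4 : ℝ)) ^ 4 = K' ^ 4 * Ens ^ 3 := by
      rw [mul_pow]
      congr 1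
      rw [← Real.rpow_natCast (Ens ^ (3 / 4 : ℝ)) 4, ← Real.rpow_mul hEns]
      norm_num
    have e2 : (2 * c * D ^ (1 / 4 : ℝ)) ^ 4 = 16 * c ^ 4 * D := by
      rw [mul_pow, mul_pow]
      have : (D ^ (1 / 4 : ℝ)) ^ 4 = D := by
        rw [← Real.rpow_natCast (D ^ (1 / 4 : ℝ)) 4, ← Real.rpow_mul hD]
        norm_num
      rw [this]; norm_num
    rw [e1, e2]; exact h1
  calc K' * Ens ^ (3 / 4 : ℝ) * D ^ (3 / 4 : ℝ) ≤ 2 * c * D ^ (1 / 4 : ℝ) * D ^ (3 / 4 : ℝ) :=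
        mul_le_mul_of_nonneg_right hroot (by positivity)
    _ = 2 * c * (D ^ (1 / 4 : ℝ) * D ^ (3 / 4 : ℝ)) := by ring
    _ = 2 * c * D := by
        rw [← Real.rpow_add' hD (by norm_num : (1 / 4 : ℝ) + 3 / 4 ≠ 0)]
        norm_num

/-- **Leray's lemma (1934, §22) for Fourier-side mild solutions, from the balance stub.** There is an
absolute `θ > 0` such that for every Fourier-mild `V` on `[t₀,t₁]` and `s ∈ [t₀,t₁]`: if the scale-invariant
product (energy × enstrophy) satisfies `E(s)·Ens(s) ≤ θ c⁴` at time `s`, then the enstrophy never again exceeds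
`Ens(s)` on `[s,t₁]`. Proof: with `K` from `enstrophyBalance` (stubs 4–5), `θ := 8/(K+1)⁴`; the set
`{r | Ens(r) ≤ Ens(s)}` is closed (continuity of `Ens`, landed) and contains, with each of its points `x < t₁`,
a right-neighbourhood: at `x`, `E(x)Ens(x) ≤ E(s)Ens(s) ≤ θc⁴ < 16c⁴/(K+1)⁴` (energy inequality), which
persists strictly on some `[x,x+δ]` by continuity; there `Ens' = -2cD + P ≤ 0` (`production_le_dissipation`
with Cauchy–Schwarz `Ens² ≤ E·D`), so `Ens` is non-increasing on `[x,x+δ]` (mean value theorem). -/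
theorem leray_threshold :
    ∃ θ : ℝ, 0 < θ ∧ ∀ (c : ℝ) (K₀ : ℕ) (t₀ t₁ : ℝ) (V : ℝ → EuclideanSpace ℝ (Fin 3) → Fin 3 → ℂ),
      Literature.Analysis.FluidPDE.FourierNS.IsFourierMild c K₀ t₀ t₁ V →
      ∀ s ∈ Set.Icc t₀ t₁,
        (∫ ξ, ∑ l, ‖V s ξ l‖ ^ 2) * (∫ ξ, ‖ξ‖ ^ 2 * ∑ l, ‖V s ξ l‖ ^ 2) ≤ θ * c ^ 4 →
        ∀ t ∈ Set.Icc s t₁, (∫ ξ, ‖ξ‖ ^ 2 * ∑ l, ‖V t ξ l‖ ^ 2) ≤ ∫ ξ, ‖ξ‖ ^ 2 * ∑ l, ‖V s ξ l‖ ^ 2 := by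
  obtain ⟨K, hK0, hbal⟩ := enstrophyBalance
  set K' : ℝ := K + 1 with hK'
  have hK'pos : 0 < K' := by rw [hK']; linarith
  refine ⟨8 / K' ^ 4, by positivity, ?_⟩
  intro c K₀ t₀ t₁ V h s hs hsmall t ht
  have hc : 0 < c := h.hc
  -- the three functionals
  set Ens : ℝ → ℝ := fun r => ∫ ξ, ‖ξ‖ ^ 2 * ∑ l, ‖V r ξ l‖ ^ 2 with hEns
  set E : ℝ → ℝ := fun r => ∫ ξ, ∑ l, ‖V r ξ l‖ ^ 2 with hE
  set D : ℝ → ℝ := fun r => ∫ ξ, ‖ξ‖ ^ 4 * ∑ l, ‖V r ξ l‖ ^ 2 with hD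
  have hEns0 : ∀ r, 0 ≤ Ens r := fun r => integral_nonneg fun ξ => by positivity
  have hE0 : ∀ r, 0 ≤ E r := fun r => integral_nonneg fun ξ => Finset.sum_nonneg fun l _ => sq_nonneg _
  have hD0 : ∀ r, 0 ≤ D r := fun r => integral_nonneg fun ξ => by positivity
  have hEnsc : Continuous Ens := Leray.continuous_enstrophy h
  have hEc : Continuous E := Leray.continuous_energy h
  -- energy inequality from `s`
  have hEmono : ∀ r ∈ Icc s t₁, E r ≤ E s := fun r hr =>
    Registered.energyIneq c K₀ s t₁ V (h.mono hs.1 hs.2 le_rfl) r hr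
  -- the derivative is nonpositive wherever `E · Ens < 16 c⁴ / K'⁴`
  have hderiv : ∀ r ∈ Ioo t₀ t₁, E r * Ens r ≤ 16 * c ^ 4 / K' ^ 4 →
      DifferentiableAt ℝ Ens r ∧ deriv Ens r ≤ 0 := by
    intro r hr hsm
    obtain ⟨P, hP, hPb⟩ := hbal c K₀ t₀ t₁ V h r hr
    refine ⟨hP.differentiableAt, ?_⟩
    rw [hP.deriv]
    have hsm' : K' ^ 4 * (E r * Ens r) ≤ 16 * c ^ 4 := by
      rw [le_div_iff₀ (by positivity)] at hsm; linarith
    have hprod := production_le_dissipation hK'pos.le (hEns0 r) (hD0 r) hc.le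
      (enstrophy_sq_le h r) hsm'
    have hPle : |P| ≤ 2 * c * D r := by
      calc |P| ≤ K * Ens r ^ (3 / 4 : ℝ) * D r ^ (3 / 4 : ℝ) := hPb
        _ ≤ K' * Ens r ^ (3 / 4 : ℝ) * D r ^ (3 / 4 : ℝ) := by
            gcongr; rw [hK']; linarith
        _ ≤ 2 * c * D r := hprod
    have := (abs_le.1 hPle).2
    show -(2 * c) * D r + P ≤ 0
    linarith
  -- the bootstrap
  set S : Set ℝ := {r | Ens r ≤ Ens s} with hSdef
  have hSclosed : IsClosed S := isClosed_le hEnsc continuous_const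
  have key : Icc s t₁ ⊆ S := by
    apply IsClosed.Icc_subset_of_forall_mem_nhdsWithin (hSclosed.inter isClosed_Icc) (le_refl (Ens s))
    rintro x ⟨hxS, hxs, hxt₁⟩
    -- at `x`: `E x · Ens x ≤ E s · Ens s ≤ 8c⁴/K'⁴ < 16c⁴/K'⁴`
    have hx1 : E x * Ens x < 16 * c ^ 4 / K' ^ 4 := by
      have h1 : E x * Ens x ≤ E s * Ens s :=
        mul_le_mul (hEmono x ⟨hxs, hxt₁.le⟩) hxS (hEns0 x) (hE0 s)
      have h2 : (8 / K' ^ 4) * c ^ 4 < 16 * c ^ 4 / K' ^ 4 := by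
        rw [div_mul_eq_mul_div, div_lt_div_iff_of_pos_right (by positivity)]
        nlinarith [pow_pos hc 4]
      linarith
    -- persists on a right-neighbourhood inside `(t₀, t₁)`
    have hcont : ContinuousAt (fun r => E r * Ens r) x := (hEc.mul hEnsc).continuousAt
    have hev : ∀ᶠ r in 𝓝 x, E r * Ens r < 16 * c ^ 4 / K' ^ 4 := hcont.eventually (gt_mem_nhds hx1)
    obtain ⟨δ, hδpos, hδ⟩ := Metric.eventually_nhds_iff.1 hev
    set δ' : ℝ := min (δ / 2) ((t₁ - x) / 2) with hδ'
    have hδ'pos : 0 < δ' := lt_min (by linarith) (by linarith)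
    have hδ'δ : δ' < δ := lt_of_le_of_lt (min_le_left _ _) (by linarith)
    have hδ't : x + δ' < t₁ := by
      have : δ' ≤ (t₁ - x) / 2 := min_le_right _ _
      linarith
    -- `Ens` is non-increasing on `[x, x + δ']`
    have hanti : AntitoneOn Ens (Icc x (x + δ')) := by
      apply antitoneOn_of_deriv_nonpos (convex_Icc _ _) hEnsc.continuousOn
      · intro r hr
        rw [interior_Icc] at hr
        have hr' : r ∈ Ioo t₀ t₁ := ⟨lt_of_le_of_lt hs.1 (lt_of_le_of_lt hxs hr.1), hr.2.trans hδ't⟩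
        have hsm : E r * Ens r ≤ 16 * c ^ 4 / K' ^ 4 := by
          refine (hδ (show dist r x < δ from ?_)).le
          rw [Real.dist_eq, abs_lt]; constructor <;> linarith [hr.1, hr.2]
        exact (hderiv r hr' hsm).1.differentiableWithinAt
      · intro r hr
        rw [interior_Icc] at hr
        have hr' : r ∈ Ioo t₀ t₁ := ⟨lt_of_le_of_lt hs.1 (lt_of_le_of_lt hxs hr.1), hr.2.trans hδ't⟩
        have hsm : E r * Ens r ≤ 16 * c ^ 4 / K' ^ 4 := by
          refine (hδ (show dist r x < δ from ?_)).le
          rw [Real.dist_eq, abs_lt]; constructor <;> linarith [hr.1, hr.2]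
        exact (hderiv r hr' hsm).2
    -- hence `[x, x+δ'] ⊆ S`, a right-neighbourhood of `x`
    have hsub : Icc x (x + δ') ⊆ S := fun r hr =>
      le_trans (hanti (left_mem_Icc.2 (by linarith)) hr hr.1) hxS
    exact mem_of_superset (Icc_mem_nhdsGT (by linarith)) hsub
  exact key ht

end Summit.NavierStokesRegularity.NavierStokesRegularity.Theorems.EnvelopeBound.Leray

end
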